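import Literature.Geometry.Riemannian.CutTimeSemicontinuity
import Literature.Geometry.Riemannian.ExpMapIndexForm
import Literature.Geometry.Riemannian.CutLocusClosedHolds
import Literature.Geometry.Riemannian.MinimalSegments
import Literature.Geometry.Riemannian.CutLocusGeodesic
import Literature.Geometry.Riemannian.ExpMapGlobalSmooth
import Literature.Topology.FourManifolds.WhitneyModelChart
import Literature.Geometry.Manifold.InverseFunctionTheorem
import HarnessLib

/-!
# The injectivity domain is open; the dense chart `exp_p : ID(p) ≅ M ∖ Cut(p)` (Lee 2018, Thm. 10.34)

Topic `Geometry/Riemannian`; support file of the programme towards the named fact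
`Weinstein1968_exists_metric_two_le_multiplicity_of_mem_cutLocus` (`WeinsteinCutLocus.lean`), whose
construction is carried out inside ONE chart of `M` with dense image — the restriction of
`exp_{p₀}` to the injectivity domain `ID(p₀)`, a diffeomorphism onto `M ∖ Cut(p₀)` (Lee 2018,
Thm. 10.34). The tree has all of Thm. 10.34 (b), (c) (`lee_expMap_injectivityDomain_holds`,
`ExpMapThm1034.lean`) and the lower semicontinuity of the cut time GIVEN the absence of critical
points of `exp_p` in `ID(p)` (`cutTime_le_of_tendsto`, `CutTimeSemicontinuity.lean`), which is now a
theorem (`mfderiv_riemannianExpMap_injective_of_mem_injectivityDomain`, `ExpMapIndexForm.lean`).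
This file draws the two remaining classical conclusions, for a smooth Riemannian metric on a
compact connected Hausdorff manifold without boundary:

* `isOpen_compl_cutLocus` — `M ∖ Cut(p)` is open (the cut locus is closed, Lee Thm. 10.34 (a),
  the tree's `isClosed_cutLocus_of_compactSpace` of `CutLocusClosedHolds.lean`, landed while this
  file was written) and dense (`dense_compl_cutLocus`, `MinimalSegments.lean`);
* `isOpen_injectivityDomain` — **`ID(p)` is open** in `T_pM` (Lee, Thm. 10.34 (a): from the
  continuity of `t_cut`; here from its lower semicontinuity: if `v_k ∉ ID(p)` converge to `v₀ ≠ 0`,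
  the unit vectors `v_k/|v_k|` have cut times `≤ |v_k|`, a subsequence of which converges, so
  `t_cut(v₀/|v₀|) ≤ |v₀|` by `cutTime_le_of_tendsto`, i.e. `v₀ ∉ ID(p)`; near `0`, `ID(p)` contains
  a ball by `exists_pos_le_cutTime`).

* `exists_denseChart_riemannianExpMap` — **the dense chart**: an open partial homeomorphism
  `ψ : M ⇀ E` with source `M ∖ cutLocus p` (open, dense), target `ID(p)`, inverse `exp_p`, `C^∞`
  both ways (Thm. 10.34 (c) with the inverse function theorem).

No definitions, no named facts (D-0026).

## References

* J. M. Lee, *Introduction to Riemannian Manifolds*, 2nd ed. (2018), Prop. 10.32, Thm. 10.33,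
  Thm. 10.34 (pp. 308–311). [LeeRiemannianManifolds2018]
-/

noncomputable section

open Bundle Set Filter Function Metric
open scoped Manifold ContDiff Topology

namespace Literature.Geometry.Riemannian

open Literature.Geometry.Lorentzian
open Literature.Geometry.Lorentzian.PseudoRiemannianMetric
open Literature.Geometry.Manifold Literature.Topology.FourManifolds

variable {E : Type*} [NormedAddCommGroup E] [NormedSpace ℝ E] {H : Type*} [TopologicalSpace H]
  {I : ModelWithCorners ℝ E H} {M : Type*} [TopologicalSpace M] [ChartedSpace H M]
  [IsManifold I ∞ M] {n : ℕ∞ω} [FiniteDimensional ℝ E] [CompleteSpace E] [T2Space M]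
  [BoundarylessManifold I M]
  (g : PseudoRiemannianMetric I n E (TangentSpace I : M → Type _)) [g.HasLeviCivita]
  [CovariantDerivative.ContMDiffCovariantDerivative g.leviCivita 1]

/-! ### The complement of the cut locus is open (and dense) -/

omit [CompleteSpace E] [g.HasLeviCivita] [CovariantDerivative.ContMDiffCovariantDerivative g.leviCivita 1] in
/-- **`M ∖ Cut(p)` is open** on a compact connected Riemannian manifold (Lee 2018, Thm. 10.34 (a):
the cut locus is closed — the tree's `isClosed_cutLocus_of_compactSpace`,
`CutLocusClosedHolds.lean`) — and dense (`dense_compl_cutLocus`, `MinimalSegments.lean`).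
[cite: LeeRiemannianManifolds2018, Thm. 10.34 (a)] -/
theorem isOpen_compl_cutLocus [CompactSpace M] [ConnectedSpace M] (hn : (∞ : ℕ∞ω) ≤ n)
    (hg : g.IsRiemannian) (p : M) : IsOpen (cutLocus g hg p)ᶜ :=
  (isClosed_cutLocus_of_compactSpace g hn hg p).isOpen_compl

/-! ### The injectivity domain is open -/

omit [CompleteSpace E] [T2Space M] [BoundarylessManifold I M]
  [CovariantDerivative.ContMDiffCovariantDerivative g.leviCivita 1] in
/-- If `γ_v` minimizes on no `[0, b]` with `b > c` (`c ≥ 0`), then `t_cut(p, v) ≤ c` (definition of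
`t_cut` as a supremum). [cite: LeeRiemannianManifolds2018, p. 307] -/
theorem cutTime_le_ofReal_of_forall_not_isMinimizingUpTo (hg : g.IsRiemannian) (p : M)
    {v : TangentSpace I p} {c : ℝ} (hc0 : 0 ≤ c)
    (h : ∀ b : ℝ, c < b → ¬ IsMinimizingUpTo g hg p v b) :
    cutTime g hg p v ≤ ENNReal.ofReal c := by
  by_contra hlt
  obtain ⟨b, hcb, hb⟩ := exists_isMinimizingUpTo_of_ofReal_lt_cutTime g hg p hc0 (not_le.1 hlt)
  exact h b hcb hb

/-- **The injectivity domain `ID(p)` is open in `T_pM`** (Lee 2018, Thm. 10.34 (a)), on a compact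
connected Riemannian manifold (smooth metric). See the module docstring for the proof from the
lower semicontinuity of the cut time (`cutTime_le_of_tendsto`) and the uniform positivity of the
cut time near `0` (`exists_pos_le_cutTime`). [cite: LeeRiemannianManifolds2018, Thm. 10.34 (a)] -/
theorem isOpen_injectivityDomain [CompactSpace M] [ConnectedSpace M] (hn : (∞ : ℕ∞ω) ≤ n)
    (hg : g.IsRiemannian) (p : M) :
    IsOpen {w : E | (show TangentSpace I p from w) ∈ injectivityDomain g hg p} := by
  haveI : Fact (1 ≤ n) := ⟨le_trans (by exact_mod_cast le_top) hn⟩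
  have hc : IsGeodesicallyComplete g.leviCivita := hopfRinow_compact_geodesicallyComplete hn hg
  set S : Set E := {w : E | (show TangentSpace I p from w) ∈ injectivityDomain g hg p} with hS
  set G : E →L[ℝ] E →L[ℝ] ℝ := g.val p with hG
  have hGcont : Continuous fun u : E ↦ G u u := G.continuous₂.comp (continuous_id.prodMk continuous_id)
  -- the injectivity hypothesis of the semicontinuity theorem is a theorem
  have hID : ∀ (u : E) (s : ℝ), 1 < s → IsMinimizingUpTo g hg p (show TangentSpace I p from u) s →
      Injective (mfderiv 𝓘(ℝ, E) I
        (fun w : E ↦ riemannianExpMap g p (show TangentSpace I p from w)) u) :=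
    fun u s hs hmin ↦
      mfderiv_riemannianExpMap_injective_of_mem_injectivityDomain g hn hg hc p ⟨s, hs, hmin⟩
  -- uniform positivity of the cut time
  obtain ⟨ε, hε, hεcut⟩ := exists_pos_le_cutTime g hn hg hc p
  -- membership in `S` of small vectors: `G w w < (ε/2)²` ⇒ `w ∈ S`
  have hsmall : ∀ w : E, G w w < (ε / 2) ^ 2 → w ∈ S := by
    intro w hw
    by_cases hw0 : w = 0
    · subst hw0
      exact zero_mem_injectivityDomain hg p
    have hww : 0 < G w w := hg p (show TangentSpace I p from w) hw0
    set c : ℝ := Real.sqrt (G w w) with hc_def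
    have hcpos : 0 < c := Real.sqrt_pos.2 hww
    have hcsq : c * c = G w w := Real.mul_self_sqrt hww.le
    have hcε : c < ε / 2 := by
      have h1 : c * c < (ε / 2) ^ 2 := by rw [hcsq]; exact hw
      nlinarith
    set u : E := c⁻¹ • w with hu_def
    have hcu : c • u = w := by rw [hu_def, smul_inv_smul₀ hcpos.ne']
    have hu1 : G u u = 1 := by
      have h1 : G u u = c⁻¹ * c⁻¹ * G w w := by
        rw [hu_def]
        simp only [map_smul, FunLike.coe_smul, Pi.smul_apply, smul_eq_mul]
        ring
      rw [h1, ← hcsq]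
      field_simp
    -- `γ_u` minimizes up to `2c < ε`, i.e. `γ_w` up to `2 > 1`
    have hmin : IsMinimizingUpTo g hg p (show TangentSpace I p from u) (c * 2) :=
      (hεcut u hu1).1 (c * 2) (by positivity) (by linarith)
    refine ⟨2, one_lt_two, ?_⟩
    show IsMinimizingUpTo g hg p (show TangentSpace I p from w) 2
    rw [← hcu]
    exact (isMinimizingUpTo_smul_iff hg hc p (show TangentSpace I p from u) hcpos 2).2 hmin
  -- the complement is sequentially closed
  rw [← isClosed_compl_iff]
  refine IsSeqClosed.isClosed fun v v₀ hv hvt ↦ ?_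
  intro hv₀S
  -- every `v k` is far from `0`, hence so is `v₀`
  have hfar : ∀ k, (ε / 2) ^ 2 ≤ G (v k) (v k) := fun k ↦ not_lt.1 fun h ↦ hv k (hsmall _ h)
  have hG0 : (ε / 2) ^ 2 ≤ G v₀ v₀ :=
    ge_of_tendsto ((hGcont.tendsto v₀).comp hvt) (Eventually.of_forall hfar)
  have hε2 : 0 < (ε / 2) ^ 2 := by positivity
  have hGv₀ : 0 < G v₀ v₀ := hε2.trans_le hG0
  have hGvk : ∀ k, 0 < G (v k) (v k) := fun k ↦ hε2.trans_le (hfar k)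
  -- norms and unit vectors
  set c : ℕ → ℝ := fun k ↦ Real.sqrt (G (v k) (v k)) with hc_def
  set c₀ : ℝ := Real.sqrt (G v₀ v₀) with hc₀_def
  have hc₀pos : 0 < c₀ := Real.sqrt_pos.2 hGv₀
  have hckpos : ∀ k, 0 < c k := fun k ↦ Real.sqrt_pos.2 (hGvk k)
  have hct : Tendsto c atTop (𝓝 c₀) :=
    ((Real.continuous_sqrt.comp hGcont).tendsto v₀).comp hvt
  set u : ℕ → E := fun k ↦ (c k)⁻¹ • v k with hu_def
  set u₀ : E := c₀⁻¹ • v₀ with hu₀_def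
  have hunit : ∀ (w : E) (a : ℝ), 0 < G w w → a = Real.sqrt (G w w) → G (a⁻¹ • w) (a⁻¹ • w) = 1 := by
    intro w a hw ha
    have hapos : 0 < a := by rw [ha]; exact Real.sqrt_pos.2 hw
    have hasq : a * a = G w w := by rw [ha]; exact Real.mul_self_sqrt hw.le
    have h1 : G (a⁻¹ • w) (a⁻¹ • w) = a⁻¹ * a⁻¹ * G w w := by
      simp only [map_smul, FunLike.coe_smul, Pi.smul_apply, smul_eq_mul]
      ring
    rw [h1, ← hasq]
    field_simp
  have hu1 : ∀ k, G (u k) (u k) = 1 := fun k ↦ hunit (v k) (c k) (hGvk k) rfl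
  have hu₀1 : G u₀ u₀ = 1 := hunit v₀ c₀ hGv₀ rfl
  have hcu : ∀ k, c k • u k = v k := fun k ↦ by
    show c k • ((c k)⁻¹ • v k) = v k
    rw [smul_inv_smul₀ (hckpos k).ne']
  have hcu₀ : c₀ • u₀ = v₀ := by
    show c₀ • (c₀⁻¹ • v₀) = v₀
    rw [smul_inv_smul₀ hc₀pos.ne']
  have hut : Tendsto u atTop (𝓝 u₀) := (hct.inv₀ hc₀pos.ne').smul hvt
  -- the cut times of the `u k` lie in `[ε, c k]`
  have hcutle : ∀ k, cutTime g hg p (show TangentSpace I p from u k) ≤ ENNReal.ofReal (c k) := by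
    intro k
    refine cutTime_le_ofReal_of_forall_not_isMinimizingUpTo g hg p (hckpos k).le fun b hb hmin ↦ ?_
    refine hv k ⟨b / c k, (one_lt_div (hckpos k)).2 hb, ?_⟩
    have h := (isMinimizingUpTo_smul_iff hg hc p (show TangentSpace I p from u k) (hckpos k)
      (b / c k)).2 (by rw [mul_div_cancel₀ b (hckpos k).ne']; exact hmin)
    have key : ∀ w w' : E, w = w' → IsMinimizingUpTo g hg p (show TangentSpace I p from w) (b / c k) →
        IsMinimizingUpTo g hg p (show TangentSpace I p from w') (b / c k) := by
      rintro w w' rfl h'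
      exact h'
    exact key _ _ (hcu k) h
  have hcutge : ∀ k, ENNReal.ofReal ε ≤ cutTime g hg p (show TangentSpace I p from u k) :=
    fun k ↦ (hεcut (u k) (hu1 k)).2
  have hfin : ∀ k, cutTime g hg p (show TangentSpace I p from u k) ≠ ⊤ :=
    fun k ↦ ne_top_of_le_ne_top ENNReal.ofReal_ne_top (hcutle k)
  set t : ℕ → ℝ := fun k ↦ (cutTime g hg p (show TangentSpace I p from u k)).toReal with ht_def
  have htcut : ∀ k, cutTime g hg p (show TangentSpace I p from u k) = ENNReal.ofReal (t k) :=
    fun k ↦ (ENNReal.ofReal_toReal (hfin k)).symm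
  have htε : ∀ k, ε ≤ t k := fun k ↦ by
    have h := hcutge k
    rw [htcut k] at h
    exact (ENNReal.ofReal_le_ofReal_iff ENNReal.toReal_nonneg).1 h
  have htc : ∀ k, t k ≤ c k := fun k ↦ by
    have h := hcutle k
    rw [htcut k] at h
    exact (ENNReal.ofReal_le_ofReal_iff (hckpos k).le).1 h
  have htpos : ∀ k, 0 < t k := fun k ↦ hε.trans_le (htε k)
  -- a convergent subsequence of the cut times
  obtain ⟨R, hR⟩ := (hct.isCompact_insert_range).bddAbove
  have htR : ∀ k, t k ≤ R := fun k ↦ (htc k).trans (hR (mem_insert_of_mem _ (mem_range_self k)))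
  obtain ⟨t₀, -, φ, hφ, htφ⟩ :=
    isCompact_Icc.tendsto_subseq (x := t) (s := Icc ε R) fun k ↦ ⟨htε k, htR k⟩
  -- lower semicontinuity along the subsequence
  have hle : cutTime g hg p (show TangentSpace I p from u₀) ≤ ENNReal.ofReal t₀ :=
    cutTime_le_of_tendsto g hn hg hc p hID (u ∘ φ) (t ∘ φ) u₀ t₀ (fun i ↦ hu1 (φ i))
      (fun i ↦ htpos (φ i)) (fun i ↦ htcut (φ i)) (hut.comp hφ.tendsto_atTop) htφ
  have ht₀c : t₀ ≤ c₀ :=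
    le_of_tendsto_of_tendsto htφ (hct.comp hφ.tendsto_atTop) (Eventually.of_forall fun i ↦ htc (φ i))
  -- but `γ_{v₀}` minimizes beyond `1`
  obtain ⟨s, hs, hmin₀⟩ := hv₀S
  have hminu : IsMinimizingUpTo g hg p (show TangentSpace I p from u₀) (c₀ * s) := by
    refine (isMinimizingUpTo_smul_iff hg hc p (show TangentSpace I p from u₀) hc₀pos s).1 ?_
    have key : ∀ w w' : E, w = w' → IsMinimizingUpTo g hg p (show TangentSpace I p from w') s →
        IsMinimizingUpTo g hg p (show TangentSpace I p from w) s := by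
      rintro w w' rfl h'
      exact h'
    exact key _ _ hcu₀ hmin₀
  have h1 : ENNReal.ofReal (c₀ * s) ≤ cutTime g hg p (show TangentSpace I p from u₀) :=
    ofReal_le_cutTime_of_isMinimizingUpTo g hg p (by positivity) hminu
  have ht₀ε : ε ≤ t₀ := ge_of_tendsto htφ (Eventually.of_forall fun i ↦ htε (φ i))
  have h2 : c₀ * s ≤ t₀ :=
    (ENNReal.ofReal_le_ofReal_iff (by linarith)).1 (h1.trans hle)
  nlinarith [hs, hc₀pos, ht₀c, h2]

/-! ### The dense chart `exp_p|_{ID(p)} : ID(p) ≅ M ∖ Cut(p)` -/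

/-- **The dense chart of a compact Riemannian manifold at a point** (Lee 2018, Thm. 10.34: "the
restriction of `exp_p` to `ID(p)` is a diffeomorphism onto `M ∖ Cut(p)`", with (a) "`Cut(p)` is a
closed subset of measure zero" in the weak form "`M ∖ Cut(p)` is open and dense"): for a smooth
Riemannian metric on a compact connected Hausdorff manifold without boundary and `p ∈ M` there is
an open partial homeomorphism `ψ : M ⇀ T_pM = E` with source `M ∖ cutLocus p` — open and dense —
and target `ID(p)`, whose inverse is `exp_p`, `C^∞` in both directions. Assembled from the tree's
Thm. 10.34 (b), (c) (`injOn_riemannianExpMap_injectivityDomain`,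
`image_injectivityDomain_eq_compl_geodesicCutLocus`, `mfderiv_riemannianExpMap_injective_of_mem_injectivityDomain`,
`cutLocus_eq_geodesicCutLocus_of_compactSpace`), `isOpen_injectivityDomain`, the inverse function
theorem (`isLocalDiffeomorphAt_of_mfderiv`) and `exists_chart_of_injOn_of_isLocalDiffeomorphAt`.
This is the single chart inside which Weinstein's construction is carried out.
[cite: LeeRiemannianManifolds2018, Thm. 10.34] -/
theorem exists_denseChart_riemannianExpMap [CompactSpace M] [ConnectedSpace M] [I.Boundaryless]
    (hn : (∞ : ℕ∞ω) ≤ n) (hg : g.IsRiemannian) (p : M) :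
    ∃ ψ : OpenPartialHomeomorph M E,
      ψ.source = (cutLocus g hg p)ᶜ ∧ Dense ψ.source ∧
      ψ.target = {w : E | (show TangentSpace I p from w) ∈ injectivityDomain g hg p} ∧
      (∀ w : E, ψ.symm w = riemannianExpMap g p (show TangentSpace I p from w)) ∧
      (∀ x ∈ ψ.source, riemannianExpMap g p (show TangentSpace I p from ψ x) = x) ∧
      ContMDiffOn I 𝓘(ℝ, E) ∞ ψ ψ.source ∧ ContMDiffOn 𝓘(ℝ, E) I ∞ ψ.symm ψ.target := by
  haveI : Fact (1 ≤ n) := ⟨le_trans (by exact_mod_cast le_top) hn⟩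
  have hc : IsGeodesicallyComplete g.leviCivita := hopfRinow_compact_geodesicallyComplete hn hg
  set W : Set E := {w : E | (show TangentSpace I p from w) ∈ injectivityDomain g hg p} with hW
  have hWo : IsOpen W := isOpen_injectivityDomain g hn hg p
  set f : E → M := fun w ↦ riemannianExpMap g p (show TangentSpace I p from w) with hf
  have hfs : ContMDiff 𝓘(ℝ, E) I ∞ f := contMDiff_riemannianExpMap g hn hc p
  -- local diffeomorphism at the points of `W`
  have hloc : ∀ w ∈ W, IsLocalDiffeomorphAt 𝓘(ℝ, E) I ∞ f w := by
    intro w hw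
    set A : E →L[ℝ] E := mfderiv 𝓘(ℝ, E) I f w with hA
    have hAinj : Injective (A : E →ₗ[ℝ] E) :=
      mfderiv_riemannianExpMap_injective_of_mem_injectivityDomain g hn hg hc p hw
    set L₀ : E ≃ₗ[ℝ] E := LinearMap.linearEquivOfInjective (A : E →ₗ[ℝ] E) hAinj rfl with hL₀
    refine isLocalDiffeomorphAt_of_mfderiv (by simp) hWo hw hfs.contMDiffOn
      L₀.toContinuousLinearEquiv ?_
    exact ContinuousLinearMap.ext fun u ↦ rfl
  have hinj : InjOn f W := injOn_riemannianExpMap_injectivityDomain g hn hg hc p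
  obtain ⟨ψ, hsrc, htgt, hψsymm, hψleft, hψs, hψsymms⟩ :=
    exists_chart_of_injOn_of_isLocalDiffeomorphAt (I := 𝓘(ℝ, E)) (J := I) (n := ∞) hWo hloc hinj
  -- the source is `exp_p(ID(p)) = M ∖ Cut(p)`
  have himage : f '' W = (cutLocus g hg p)ᶜ := by
    rw [cutLocus_eq_geodesicCutLocus_of_compactSpace hn hg p]
    exact image_injectivityDomain_eq_compl_geodesicCutLocus g hn hg hc p
  have hsrc' : ψ.source = (cutLocus g hg p)ᶜ := hsrc.trans himage
  refine ⟨ψ, hsrc', ?_, htgt, hψsymm, fun x hx ↦ ?_, hψs, hψsymms⟩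
  · rw [hsrc']
    exact dense_compl_cutLocus hg p
  · show f (ψ x) = x
    rw [← hψsymm]
    exact ψ.left_inv hx

end Literature.Geometry.Riemannian

end
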